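import Summits.QuantumAdvantage.AdviceFreeQNC0.LowDegreeGapStrategies
import Summits.QuantumAdvantage.AdviceFreeQNC0.WalkTransport
import HarnessLib

/-!
# Route RingFrame, crux α `RingToElim` (stmt-QuantumAdvantage-19119): the low-degree gap theorem
# read on the RING — a cycle-HLF device that follows the canonical guess on one polylog arc fails

Support theorem for the crux item α in the language of the rung leaf `RingHard 2`
(`Literature…RingHLF.Rel`, the graph-state relation of the `(n+1)`-cycle).  The transport of
`WalkTransport.lean` (`rel_iff_ringWinU`: on the odd class, `Rel x z(x)` iff the walk strategy
`y_g(u) = z_g(xOfU u) ⊕ t_g(xOfU u)` wins the walk game at charge `n + 2` at `u = uVec x`;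
`t = tGuess` the canonical affine guess `t(x)_j = x_j ⊕ x_{j+1}` of `RingCanonical.lean`) sends a
ring strategy that AGREES WITH THE CANONICAL GUESS on a set of output positions to a walk
strategy VANISHING on that set.  Hence the cell's low-degree gap theorem
(`ringWinU_lowDegGap_le`, `LowDegreeGapStrategies.lean`: one run of `(log₂ n)^{2C'+1}`
unselected positions costs a polylog-degree walk strategy a constant fraction, `θ = 1 − η₀`
uniformly) gives:

* `ringRel_arcAgreement_le`: there is `θ < 1` such that for every `C`, all large `n`, every arc
  `(p, p + ℓ)` of output positions of the `(n+1)`-cycle with `p + ℓ ≤ n` and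
  `ℓ ≥ (log₂ n)^{4C+3}`, and every tuple `P` of `𝔽₂`-polynomials on `{0,1}^{n+1}` of degree
  `≤ (log₂ (n+1))^C`: if `[P_g(x) = 1] = t(x)_g` for the positions `p < g < p + ℓ` (the device
  outputs the canonical affine guess on that arc, and anything of polylog degree elsewhere), then
  `Rel x (P x)` holds for at most `θ·2^{n+1}` measurement patterns `x`.

So a classical polylog-degree device can beat the `(1 − θ)`-failure floor only by DEVIATING from
the canonical affine guess inside EVERY arc of `(log₂ n)^{4C+3}` consecutive vertices (an arc
through the base point `n ↔ 0` of the chart contains a base-point-free half).  This supersedes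
`ringRel_windowDeviation_le` / `ringRel_baseDeviation_le` (`RingFrameRingToElimWindowLadder.lean`:
deviation confined to boundedly many arcs, `θ_t → 1`): here the deviation set is arbitrary
outside one arc and `θ` is absolute.

The cell's statement (prover qn-prover-3; a special case of crux α of route RingFrame); not in
print.  WHAT THIS IS NOT: not `RingHard 2` / α — devices deviating from `t` inside every polylog
arc (everywhere-dense walk strategies) are untouched; nothing on `LDMAPolylog`, `TRPlus`; no
separation.
-/

-- the sub-problem namespace `Summit.QuantumAdvantage.QuantumAdvantage` repeats the summit name by design (D-0017)
set_option linter.dupNamespace false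

noncomputable section

namespace Summit.QuantumAdvantage.QuantumAdvantage.Theorems

open Finset Summit.QuantumAdvantage.AdviceFreeQNC0
open Literature.Computability.QuantumComplexity Literature.Computability.QuantumComplexity.RingHLF
open Literature.Computability.MetaComplexity Literature.Computability.MetaComplexity.Smolensky

/-- Degree bookkeeping of the transport (as in `WalkTransport.lean`): `(log₂ (n+1))^c ≤
(log₂ n)^(2c+1)` and `1 ≤ (log₂ n)^(2c+1)` for `n ≥ 4`. [folklore] -/
private theorem transport_degree_le_gap {n : ℕ} (hn : 4 ≤ n) (c : ℕ) :
    (Nat.log 2 (n + 1)) ^ c ≤ (Nat.log 2 n) ^ (2 * c + 1) ∧ 1 ≤ (Nat.log 2 n) ^ (2 * c + 1) := by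
  have hlog : 2 ≤ Nat.log 2 n := Nat.le_log_of_pow_le (by norm_num) (by omega)
  have hsucc : Nat.log 2 (n + 1) ≤ Nat.log 2 n + 1 := by
    have h : n + 1 ≤ 2 ^ (Nat.log 2 n + 1) := Nat.lt_pow_succ_log_self (by norm_num) n
    calc Nat.log 2 (n + 1) ≤ Nat.log 2 (2 ^ (Nat.log 2 n + 1)) := Nat.log_mono_right h
      _ = Nat.log 2 n + 1 := Nat.log_pow (by norm_num) _
  have h1 : Nat.log 2 (n + 1) ≤ Nat.log 2 n * Nat.log 2 n := by nlinarith
  constructor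
  · calc (Nat.log 2 (n + 1)) ^ c ≤ (Nat.log 2 n * Nat.log 2 n) ^ c := Nat.pow_le_pow_left h1 c
      _ = (Nat.log 2 n) ^ (2 * c) := by rw [← pow_two, ← pow_mul]
      _ ≤ (Nat.log 2 n) ^ (2 * c + 1) := Nat.pow_le_pow_right (by omega) (by omega)
  · exact Nat.one_le_pow _ _ (by omega)

/-- **Cycle-HLF devices that follow the canonical guess on one polylog arc fail on a constant
fraction.**  There is `θ < 1` such that for every `C` and all large `n`, for every arc of output
positions `p < g < p + ℓ` of the `(n+1)`-cycle with `p + ℓ ≤ n` and `(log₂ n)^{4C+3} ≤ ℓ`, and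
every tuple `P` of `𝔽₂`-polynomials on `{0,1}^{n+1}` of degree `≤ (log₂ (n+1))^C` whose output
bits `[P_g(x) = 1]` coincide with the canonical guess `t(x)_g` (`tGuess`) at every position of
the arc: `RingHLF.Rel x (P x)` holds for at most `θ·2^{n+1}` patterns `x`.  (Cell statement;
transport `rel_iff_ringWinU` of the walk theorem `ringWinU_lowDegGap_le` at `C' = 2C + 1`, the
even class costing at most `2ⁿ`; support for crux α `RingToElim`.) [cite: Srinivasan2023, Lemma 3.1] -/
theorem ringRel_arcAgreement_le :
    ∃ θ : ℝ, θ < 1 ∧ ∀ C : ℕ, ∃ n₀ : ℕ, ∀ n ≥ n₀, ∀ p ℓ : ℕ, p + ℓ ≤ n →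
      (Nat.log 2 n) ^ (4 * C + 3) ≤ ℓ →
      ∀ P : Fin (n + 1) → CubeFn (ZMod 2) (n + 1),
        (∀ i, P i ∈ lowDeg (ZMod 2) (n + 1) ((Nat.log 2 (n + 1)) ^ C)) →
        (∀ g : Fin (n + 1), p < g.val → g.val < p + ℓ → ∀ x, decide (P g x = 1) = tGuess x g) →
          ((univ.filter fun x : Fin (n + 1) → Bool =>
              Rel x (fun i => decide (P i x = 1))).card : ℝ) ≤ θ * (2 : ℝ) ^ (n + 1) := by
  classical
  obtain ⟨θ', hθ', hW⟩ := ringWinU_lowDegGap_le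
  refine ⟨(1 + θ') / 2, by linarith, fun C => ?_⟩
  obtain ⟨n₀, hn₀⟩ := hW (2 * C + 1)
  refine ⟨max n₀ 4, fun n hn p ℓ hpl hℓ P hP hdev => ?_⟩
  have hn₀n : n₀ ≤ n := le_trans (le_max_left _ _) hn
  have hn4 : 4 ≤ n := le_trans (le_max_right _ _) hn
  -- the transported walk strategy, its degree and its clean run
  set z : (Fin (n + 1) → Bool) → (Fin (n + 1) → Bool) := fun x i => decide (P i x = 1)
    with hz
  set y : Fin (n + 1) → (Fin n → Bool) → Bool :=
    fun g u => xor (z (xOfU u) g) (tGuess (xOfU u) g) with hy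
  obtain ⟨hdegle, hone⟩ := transport_degree_le_gap hn4 C
  have hdeg : ∀ g, HasDeg (y g) ((Nat.log 2 n) ^ (2 * C + 1)) := fun g =>
    hasDeg_transport hone (P g) (lowDeg_mono hdegle (hP g)) g
  have hgap : ∀ g : Fin (n + 1), p < g.val → g.val < p + ℓ → ∀ u, y g u = false := by
    intro g hg1 hg2 u
    simp only [hy, hz, hdev g hg1 hg2 (xOfU u), Bool.xor_self]
  have hℓ' : (Nat.log 2 n) ^ (2 * (2 * C + 1) + 1) ≤ ℓ := by
    rw [show 2 * (2 * C + 1) + 1 = 4 * C + 3 by ring]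
    exact hℓ
  have hwin := hn₀ n hn₀n p ℓ hpl hℓ' (n + 2) y hdeg hgap
  -- split the solved patterns by the parity of the number of zeros
  set Sx := univ.filter fun x : Fin (n + 1) → Bool => Rel x (z x) with hSx
  set OddZ : (Fin (n + 1) → Bool) → Prop := fun x =>
    (univ.filter fun j : Fin (n + 1) => x j = false).card % 2 = 1 with hOddZ
  have hsplit : Sx.card = (Sx.filter OddZ).card + (Sx.filter fun x => ¬ OddZ x).card :=
    (Finset.card_filter_add_card_filter_not _).symm
  have heven : (Sx.filter fun x => ¬ OddZ x).card ≤ 2 ^ n := by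
    refine le_trans (Finset.card_le_card ?_) card_even_class_le
    intro x hx
    rw [mem_filter] at hx ⊢
    exact ⟨mem_univ _, hx.2⟩
  have hodd : (Sx.filter OddZ).card ≤
      (univ.filter fun u : Fin n → Bool => ringWinU (n + 2) y u = true).card := by
    refine Finset.card_le_card_of_injOn uVec ?_ ?_
    · intro x hx
      rw [Finset.mem_coe, mem_filter, hSx, mem_filter] at hx
      rw [Finset.mem_coe, mem_filter]
      exact ⟨mem_univ _, (rel_iff_ringWinU (by omega) x hx.2 z).1 hx.1.2⟩
    · intro x₁ hx₁ x₂ hx₂ h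
      rw [Finset.mem_coe, mem_filter] at hx₁ hx₂
      rw [← xOfU_uVec (by omega) x₁ hx₁.2, ← xOfU_uVec (by omega) x₂ hx₂.2, h]
  -- arithmetic
  have hS : (Sx.card : ℝ) ≤ 2 ^ n + θ' * 2 ^ n := by
    have h1 : (Sx.card : ℝ) ≤
        ((Sx.filter fun x => ¬ OddZ x).card : ℝ) + ((Sx.filter OddZ).card : ℝ) := by
      rw [hsplit]; push_cast; linarith
    have h2 : ((Sx.filter fun x => ¬ OddZ x).card : ℝ) ≤ 2 ^ n := by exact_mod_cast heven
    have h3 : ((Sx.filter OddZ).card : ℝ) ≤ θ' * 2 ^ n :=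
      le_trans (by exact_mod_cast hodd) hwin
    linarith
  have hpow : (2 : ℝ) ^ (n + 1) = 2 * 2 ^ n := by ring
  calc (Sx.card : ℝ) ≤ 2 ^ n + θ' * 2 ^ n := hS
    _ = (1 + θ') / 2 * (2 : ℝ) ^ (n + 1) := by rw [hpow]; ring

end Summit.QuantumAdvantage.QuantumAdvantage.Theorems
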